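import Summits.ResolutionOfSingularities.ResolutionOfSingularities.Theorems.PurelyInseparableDim4ResConeTwoSlotLedger
import Summits.ResolutionOfSingularities.ResolutionOfSingularities.Theorems.PurelyInseparableDim4ResConeTwoSlotDivisibilityPow
import HarnessLib
import HarnessLib.Audit.Tags

/-!
# Purely inseparable four-folds — THE PAIR LEDGER IN A JET FRAME AT A GENERAL POWER: divisibility readings of a
# two-letter power-cone regime of exponent `d` (cell `res-dim4-pi`, K2(p) lane, slice B; K24b-FRAME βC3 =
# K24a-β3a with `3 ↦ d`, and its C∞ instance `d = 4`, `p = 5`)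

[OURS · counted 0 · cell `res-dim4-pi` · K2(p) lane (holder res-dim4-p-12 g3); res-dim4-p-1 g4's β3a
`…ResConeTwoSlotLedger` §§3–4 (`d = 3`, the K24a two-slot game) VERBATIM with the cube replaced by a general power `d`
over res-dim4-typ-1 g3's `…ResConeTwoSlotDivisibilityPow`; the ledger (`pair_hasse_ledger_of_born_at`, res-dim4-p-2 g4 /
res-dim4-p-1 g4), the frame push (`ledger_tsch`) and the jet shape (`hasseDeriv_eq_X_mul_add_of_jet`) were already
`d`-generic · seat res-dim4-typ-1 g3.]  Nothing here proves K2(p)/K2(5), `NoIsolatedTrap p p` or resolution of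
singularities in dimension ≥ 4 / characteristic `p` — NOT proved.  AI kernel work, weaker than expert review.

* §1 **`coeff_tsch_eq_zero_of_pair_ledger_pow`** — a pair ledger `U·G = S·x_A x_B + T·(D_f^{(d−1)} G)^d`, `U(0) ≠ 0`,
  in a frame `x_f ↦ x_f + φ(u)` Tschirnhaus to order `N` at level `d − 1` gives `coeff_n (τ_φ G) = 0` for `|n| ≤ N`,
  `n_f < d`, `n_A = 0 ∨ n_B = 0`; `reading_clean_tsch_eq_zero_of_pair_ledger_pow` — read on `clean_q (τ_φ (x^r·G))`.
* §2 **`frame_reading_eq_zero_of_born_pow`** — chain level, `2 ≤ d < p`: on a power-cone stretch with frame data, two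
  stretch-born kept letters `A, B` and a vertex-carrying letter `f ∉ {A, B}` off the ledger give the readings
  `coeff_{r_k + m} (clean_p (τ_φ F_k)) = 0`, `|m| ≤ N`, `m_f < d`, `m_A = 0 ∨ m_B = 0`, in ANY frame Tschirnhaus to
  order `N` at `f`; **`frame_reading_eq_zero_of_born_four`** — the C∞ numbers `p = 5`, `d = 4` (K24b βC3: the
  «`G̃`-monomials of `f`-degree `≤ 3` off `(x_λ x_μ)` vanish mod `𝔪₀^{N+1}`» input of the `u`-pinning and of the
  window law's near non-ledger exclusion).
[cite: CossartJannsenSaito2020, Thm. 3.10(4), Thm. 3.14] bears_on: LADDER-RESOLUTION:D157-DOOR2 (res-dim4-pi · K2(p) ·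
slice B · K24b-FRAME βC3).  Supports stmt-ResolutionOfSingularities-16155 (helper).
-/

set_option linter.dupNamespace false -- mandated namespace of this single-conjunct summit

noncomputable section

namespace Summit.ResolutionOfSingularities.ResolutionOfSingularities.Theorems.PIDim4

namespace ResCone

open MvPolynomial Finset FrameChange
open Literature.AlgebraicGeometry.Resolution
open Literature.AlgebraicGeometry.Resolution.CentreBlowup
open Literature.AlgebraicGeometry.Resolution.Hauser2010
open Literature.AlgebraicGeometry.Resolution.HauserPerlega2019

variable {K : Type} [Field K]

/-! ## 1. The read-off in a Tschirnhaus frame at a general power -/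

section PowFrame

/-- **DIVISIBILITY READINGS IN THE FRAME, GENERAL POWER** (K24b βC3 = K24a β3 with `3 ↦ d`): a pair ledger
`U·G = S·x_A x_B + T·(D_f^{(d−1)} G)^d` with `U(0) ≠ 0` and a frame `x_f ↦ x_f + φ(u)` that is Tschirnhaus to order
`N` for `G` at level `d − 1` (`G̃ = τ_φ G` has no `x_f^{d−1}·u^m`, `|m| ≤ N`) give `coeff_n G̃ = 0` for `|n| ≤ N`,
`n_f < d`, `n_A = 0 ∨ n_B = 0`: in the jet frame the residual lies in `(x_A x_B, x_f^d) + 𝔪₀^{N+1}`. [OURS]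
[cite: CossartJannsenSaito2020, Thm. 3.14] -/
theorem coeff_tsch_eq_zero_of_pair_ledger_pow {f A B : Fin 4} (hAf : A ≠ f) (hBf : B ≠ f)
    {φ : MvPolynomial (Fin 4) K} (hφ : f ∉ φ.vars) (h0 : constantCoeff φ = 0)
    {G U S T : MvPolynomial (Fin 4) K} (hU : constantCoeff U ≠ 0) {d : ℕ}
    (hledger : U * G = S * (X A * X B) + T * hasseDeriv (Finsupp.single f (d - 1)) G ^ d) {N : ℕ}
    (hN : ∀ n : Fin 4 →₀ ℕ, n f = d - 1 → n.degree ≤ N + (d - 1) → coeff n (tsch f φ G) = 0)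
    {n : Fin 4 →₀ ℕ} (hnN : n.degree ≤ N) (hnf : n f < d) (hn : n A = 0 ∨ n B = 0) :
    coeff n (tsch f φ G) = 0 := by
  have hL := ledger_tsch hAf hBf hφ hledger
  obtain ⟨W, R, hWR, hR⟩ := hasseDeriv_eq_X_mul_add_of_jet f (d := d) (N := N) (P := tsch f φ G) hN
  have hU' : constantCoeff (tsch f φ U) ≠ 0 := by rw [constantCoeff_tsch h0]; exact hU
  exact coeff_eq_zero_of_pair_ledger_pow hU' hL hWR hR (by omega) hnf hn

/-- **The same, read on the cleaned framed state** `clean_q (τ_φ F)`, `F = x^r·G`, `r_f = 0`, general power `d`: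
`coeff_{r+m} = 0` for `|m| ≤ N`, `m_f < d`, `m_A = 0 ∨ m_B = 0` (cleaning only deletes monomials). [OURS]
[cite: CossartJannsenSaito2020, Thm. 3.14] -/
theorem reading_clean_tsch_eq_zero_of_pair_ledger_pow (q : ℕ) {f A B : Fin 4} (hAf : A ≠ f) (hBf : B ≠ f)
    {φ : MvPolynomial (Fin 4) K} (hφ : f ∉ φ.vars) (h0 : constantCoeff φ = 0)
    {F G U S T : MvPolynomial (Fin 4) K} {r : Fin 4 →₀ ℕ} (hrf : r f = 0) (hF : F = monomial r 1 * G)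
    (hU : constantCoeff U ≠ 0) {d : ℕ}
    (hledger : U * G = S * (X A * X B) + T * hasseDeriv (Finsupp.single f (d - 1)) G ^ d) {N : ℕ}
    (hN : ∀ n : Fin 4 →₀ ℕ, n f = d - 1 → n.degree ≤ N + (d - 1) → coeff n (tsch f φ G) = 0)
    {m : Fin 4 →₀ ℕ} (hmN : m.degree ≤ N) (hmf : m f < d) (hm : m A = 0 ∨ m B = 0) :
    coeff (r + m) (deletePthPowers q (tsch f φ F)) = 0 := by
  classical
  rw [coeff_deletePthPowers]
  split_ifs
  · rfl
  rw [hF, tsch_monomial_mul φ hrf, coeff_monomial_mul', if_pos le_self_add, add_tsub_cancel_left, one_mul]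
  exact coeff_tsch_eq_zero_of_pair_ledger_pow hAf hBf hφ h0 hU hledger hN hmN hmf hm

end PowFrame

/-! ## 2. Along the chain -/

section PowChainReadings

variable (p : ℕ) [hp : Fact p.Prime] [CharP K p] [DecidableEq K]

/-- **LEDGER READINGS OF A TWO-LETTER POWER-CONE REGIME IN A JET FRAME, GENERAL POWER** (chain level; K24b βC3 at
`d = 4`, `p = 5` is the C∞ instance; K24a β3 is `d = 3`): on a power-cone stretch of exponent `d` (`2 ≤ d < p`)
with frame data, at a stage `k` where two distinct boundary letters `A, B` are stretch-born and kept, a letter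
`f ∉ {A, B}` with `r_k f = 0` carries the vertex form (`ℓ_k f ≠ 0`), and `φ` is a frame at `f` Tschirnhaus to order
`N` at level `d − 1` for the residual `G_k`: `coeff_{r_k + m} (clean_p (τ_φ F_k)) = 0` for `|m| ≤ N`, `m_f < d`,
`m_A = 0 ∨ m_B = 0`. [OURS] [cite: CossartJannsenSaito2020, Thm. 3.10(4), Thm. 3.14] -/
theorem frame_reading_eq_zero_of_born_pow {c : ℕ → State K} {j : ℕ → Fin 4} {b : ℕ → Fin 4 → K}
    (hc : ∀ k, IsIsolated p (c k).F ∧ Step0 p (c k) (c (k + 1))) (hw : FreeTail.IsWitnessedChain p c j b)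
    (hr0 : ∀ e ∈ (c 0).F.support, (c 0).r ≤ e) (hfloor : ∀ k, ordZero (c k).F ≠ p) {k₀ d : ℕ} (hd2 : 2 ≤ d)
    (hdp : d < p) (hshade : ∀ k, k₀ ≤ k → (c k).shade = (d : ℕ∞)) {ℓ : ℕ → Fin 4 → K} {a0 lam : ℕ → K}
    (hform : ∀ k, k₀ ≤ k → resForm (c k) = C (a0 k) * (∑ i, C (ℓ k i) * X i) ^ d)
    (hdir : ∀ k, k₀ ≤ k → ℓ k (j k) + dotProduct (ℓ k) (b k) = 0) (hlam : ∀ k, k₀ ≤ k → lam k ≠ 0)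
    (hprop : ∀ k, k₀ ≤ k → ∀ i, i ≠ j k → ℓ (k + 1) i = lam k * ℓ k i)
    (hcarry : ∀ k, k₀ ≤ k → ∃ i, i ≠ j k ∧ ℓ k i ≠ 0) {k : ℕ} {A B f : Fin 4} (hAB : A ≠ B)
    (hAf : A ≠ f) (hBf : B ≠ f) (hℓf : ℓ k f ≠ 0) (hrf : (c k).r f = 0)
    {tA tB : ℕ} (htA : k₀ ≤ tA) (htAk : tA < k) (hjA : j tA = A)
    (hkeptA : ∀ m, tA < m → m < k → j m ≠ A ∧ b m A = 0) (htB : k₀ ≤ tB) (htBk : tB < k)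
    (hjB : j tB = B) (hkeptB : ∀ m, tB < m → m < k → j m ≠ B ∧ b m B = 0)
    {φ : MvPolynomial (Fin 4) K} (hφ : f ∉ φ.vars) (h0 : constantCoeff φ = 0) {N : ℕ}
    (hN : ∀ n : Fin 4 →₀ ℕ, n f = d - 1 → n.degree ≤ N + (d - 1) →
      coeff n (tsch f φ ((c k).F.divMonomial (c k).r)) = 0)
    {m : Fin 4 →₀ ℕ} (hmN : m.degree ≤ N) (hmf : m f < d) (hm : m A = 0 ∨ m B = 0) :
    coeff ((c k).r + m) (deletePthPowers p (tsch f φ (c k).F)) = 0 := by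
  obtain ⟨U, S, T, hU, hledger⟩ := pair_hasse_ledger_of_born_at p hc hw hr0 hfloor hd2 hdp hshade
    hform hdir hlam hprop hcarry hAB hAf.symm hBf.symm hℓf htA htAk hjA hkeptA htB htBk hjB hkeptB
  have hr := IsolatedBand.isolated_chain_forall_le hc hr0 k
  have hU' : constantCoeff U ≠ 0 := by rwa [← MvPolynomial.eval_zero]
  exact reading_clean_tsch_eq_zero_of_pair_ledger_pow p hAf hBf hφ h0 hrf (monomial_mul_divMonomial hr).symm hU'
    hledger hN hmN hmf hm

/-- **The C∞ instance** (`p = 5`, `d = 4`; K24b βC3): readings `coeff_{r_k + m} (clean₅ (τ_φ F_k)) = 0` for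
`|m| ≤ N`, `m_f < 4`, `m_A = 0 ∨ m_B = 0`. [OURS] [cite: CossartJannsenSaito2020, Thm. 3.10(4), Thm. 3.14] -/
theorem frame_reading_eq_zero_of_born_four [Fact (5 : ℕ).Prime] [CharP K 5] {c : ℕ → State K} {j : ℕ → Fin 4}
    {b : ℕ → Fin 4 → K}
    (hc : ∀ k, IsIsolated 5 (c k).F ∧ Step0 5 (c k) (c (k + 1))) (hw : FreeTail.IsWitnessedChain 5 c j b)
    (hr0 : ∀ e ∈ (c 0).F.support, (c 0).r ≤ e) (hfloor : ∀ k, ordZero (c k).F ≠ 5) {k₀ : ℕ}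
    (hshade : ∀ k, k₀ ≤ k → (c k).shade = ((4 : ℕ) : ℕ∞)) {ℓ : ℕ → Fin 4 → K} {a0 lam : ℕ → K}
    (hform : ∀ k, k₀ ≤ k → resForm (c k) = C (a0 k) * (∑ i, C (ℓ k i) * X i) ^ 4)
    (hdir : ∀ k, k₀ ≤ k → ℓ k (j k) + dotProduct (ℓ k) (b k) = 0) (hlam : ∀ k, k₀ ≤ k → lam k ≠ 0)
    (hprop : ∀ k, k₀ ≤ k → ∀ i, i ≠ j k → ℓ (k + 1) i = lam k * ℓ k i)
    (hcarry : ∀ k, k₀ ≤ k → ∃ i, i ≠ j k ∧ ℓ k i ≠ 0) {k : ℕ} {A B f : Fin 4} (hAB : A ≠ B)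
    (hAf : A ≠ f) (hBf : B ≠ f) (hℓf : ℓ k f ≠ 0) (hrf : (c k).r f = 0)
    {tA tB : ℕ} (htA : k₀ ≤ tA) (htAk : tA < k) (hjA : j tA = A)
    (hkeptA : ∀ m, tA < m → m < k → j m ≠ A ∧ b m A = 0) (htB : k₀ ≤ tB) (htBk : tB < k)
    (hjB : j tB = B) (hkeptB : ∀ m, tB < m → m < k → j m ≠ B ∧ b m B = 0)
    {φ : MvPolynomial (Fin 4) K} (hφ : f ∉ φ.vars) (h0 : constantCoeff φ = 0) {N : ℕ}
    (hN : ∀ n : Fin 4 →₀ ℕ, n f = 3 → n.degree ≤ N + 3 →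
      coeff n (tsch f φ ((c k).F.divMonomial (c k).r)) = 0)
    {m : Fin 4 →₀ ℕ} (hmN : m.degree ≤ N) (hmf : m f < 4) (hm : m A = 0 ∨ m B = 0) :
    coeff ((c k).r + m) (deletePthPowers 5 (tsch f φ (c k).F)) = 0 :=
  frame_reading_eq_zero_of_born_pow 5 hc hw hr0 hfloor (by norm_num) (by norm_num) hshade hform hdir hlam hprop
    hcarry hAB hAf hBf hℓf hrf htA htAk hjA hkeptA htB htBk hjB hkeptB hφ h0 (d := 4) hN hmN hmf hm

end PowChainReadings

end ResCone

end Summit.ResolutionOfSingularities.ResolutionOfSingularities.Theorems.PIDim4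

end
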